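import Literature.NumberTheory.Automorphic.PlaneLatticesCompanionSelfDualStrata        -- ★ (β2′-i): Hermite strata kit (`map_companion_span_eq_self_iff_of_hermite`, `companion_rescale_identities`, `exists_valuation_eq_valuation_zpow`, …)
import HarnessLib

/-!
# Self-dual companion-stable plane lattices with an EISENSTEIN (affine) CENTRE, I: the affine norm condition, the strata `k ≤ j`, and re-centring — the
# `|2| = 1`-free twin of ★ (β2′-i) `PlaneLatticesCompanionSelfDualStrata` (Flicker 1998, p. 97; Serre, Local Fields, Ch. I §6, Ch. V §2)

Topic `NumberTheory/Automorphic`; namespace `Literature.NumberTheory.Automorphic`.  THEOREMS ONLY (no definition, no instance, no notation, no named fact,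
no `sorry`).  Cell `pub/hodgecm-mathlib`, LH4 price list (P5c) «COMPANION COUNT WITH THE EISENSTEIN CENTRE» (dealer LH4-plan (g6) WORD #70∕#85∕14:57Z rulings; M6 memo
B-p08 (g40) §2(e)∕§4; FRAME half F0P3a-p02 (g22) (P5d); affine relation shape ★ B-p08 (A1)–(A4) `SelfDualLatticeAffineReductionTransport`).  Seat LH5-p01 (g5).
HONEST LABEL: HC_CM is proved only modulo the printed citations (hLiu418 = stmt-HodgeConjecture-24832, h413 = stmt-HodgeConjecture-24833) until rung 0 closes; this file is
unconditional, elementary and count-neutral.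

## What changes with respect to ★ (β2′-i)
★ (β2′-i) stratifies the self-dual (for `!![0, β; σβ, 0]`) `C(t,d)`-stable lattices (`C = !![0, −d; 1, t]`) under `|2| = 1` and `|t² − 4d| = |ϖ^{2N+1}|`, CENTRING the
Hermite parameter at `t∕2` («completing the square», ★ `norm_condition_iff`).  Here the centre is an arbitrary integer `a` carrying an AFFINE (Eisenstein) relation
`(C − a·1)² = f·(C − a·1) + e′·1` with the SHARP bound `|f| ≤ |ϖ^{j+1}|` and `|e′| = |ϖ^{2j+1}|` (so `t = 2a + f`, `χ_C(a) = −e′`).  No hypothesis on `|2|`: at a dyadic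
place `t∕2` need not be integral, `a` is.  The valuation identity replacing «completing the square» is §1: `|z² + f z − e′| = max(|z|², |e′|)` — no cancellation, because
`|z|²` is an even and `|e′|` an odd power of `|ϖ|` and `|f z|` is smaller than both (with `|f| < 1` only, this is FALSE: `f = ϖ`, `e′ = ϖ^{2j+1}` splits).  With
`a := t∕2`, `f := 0`, `e′ := (t² − 4d)∕4` (when `|2| = 1`) every statement specialises to ★ (β2′-i) token for token (`j = N`).

* §0 `companion_affine_entries` — the scalar content of the affine relation: `t − 2a = f`, `a² − ta + d = −e′`.
* §1 `valuation_sq_add_mul_sub_eq_max`, `affine_norm_condition_iff` (`ϖ^{−(2k+e)}(y′² + ty′ + d) ∈ 𝒪 ↔ k ≤ j ∧ ϖ^{−(k+e)}(y′ + a) ∈ 𝒪`).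
* §2 `exponents_of_selfDual_companionStable_affine`, `mem_selfDualStable_antidiag_companion_iff_affine` (the ★ (β2′-i) §3 twins, `N ↦ j`).
* §3 `exists_recentre_twistedTrace_eq_zero` — from the WEAK twisted-trace bound `|β·σa + σβ·a| ≤ |ϖ^{j+1+e}|` (what a rescaled cyclic frame delivers) to a centre
  `a₁ ∈ a + 𝔪^{j+1}` with `β·σa₁ + σβ·a₁ = 0` EXACTLY and an affine datum `(a₁, f₁, e₁)` of the same shape (unramified trace-one element `ε = a₀(a₀ − σa₀)⁻¹`).

## References
* [Flicker1998UnitaryFL] Y. Z. Flicker, *The unitary fundamental lemma* (1998), §6 p. 95 REMARK, p. 97 (the type-(2) lattice count).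
* [Serre1979] J.-P. Serre, *Local Fields*, GTM 67 (1979), Ch. I §1 (discrete valuations), Ch. I §6 (Eisenstein polynomials), Ch. V §2 (unramified trace).
* [Macdonald1995] I. G. Macdonald, *Symmetric Functions and Hall Polynomials*, 2nd ed. (1995), Ch. V §2 (Hermite normal form of lattices).
-/

set_option autoImplicit false

noncomputable section

open scoped ValuativeRel Matrix MatrixGroups
open Matrix ValuativeRel Finset IsLocalRing

namespace Literature.NumberTheory.Automorphic

section Scalar

variable {F : Type*} [Field F] [ValuativeRel F] {ϖ : F} (hϖ : IsUniformizingElement ϖ)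

/-! ## §0 The scalar content of the affine relation -/

omit [ValuativeRel F] in
/-- **ENTRIES OF THE AFFINE RELATION** for the companion matrix `C = !![0, −d; 1, t]`: `(C − a·1)² = f·(C − a·1) + e′·1` forces `t − 2a = f` (entry `(1,0)`) and
`a² − t a + d = −e′` (entry `(0,0)`), i.e. `χ_C(X) = (X − a)² − f(X − a) − e′`. [cite: Serre1979, Ch. I §6] -/
theorem companion_affine_entries {t d a f e' : F} (γ : GL (Fin 2) F) (hγ : (γ : Matrix (Fin 2) (Fin 2) F) = !![0, -d; 1, t])
    (hγa : ((γ : Matrix (Fin 2) (Fin 2) F) - a • (1 : Matrix (Fin 2) (Fin 2) F)) * ((γ : Matrix (Fin 2) (Fin 2) F) - a • (1 : Matrix (Fin 2) (Fin 2) F)) =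
      f • ((γ : Matrix (Fin 2) (Fin 2) F) - a • (1 : Matrix (Fin 2) (Fin 2) F)) + e' • (1 : Matrix (Fin 2) (Fin 2) F)) :
    t - 2 * a = f ∧ a * a - t * a + d = -e' := by
  have hC : (γ : Matrix (Fin 2) (Fin 2) F) - a • (1 : Matrix (Fin 2) (Fin 2) F) = !![-a, -d; 1, t - a] := by
    rw [hγ]; ext i j; fin_cases i <;> fin_cases j <;> simp
  rw [hC, Matrix.mul_fin_two] at hγa
  have h10 := congrArg (fun M : Matrix (Fin 2) (Fin 2) F => M 1 0) hγa
  have h00 := congrArg (fun M : Matrix (Fin 2) (Fin 2) F => M 0 0) hγa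
  simp at h10 h00
  exact ⟨by linear_combination h10, by linear_combination -h00 - a * h10⟩

/-! ## §1 The valuation identity replacing «completing the square» -/

include hϖ in
/-- `|ϖ^a| < |ϖ^b| ↔ b < a` (strict twin of ★ `valuation_zpow_le_valuation_zpow_iff`). [cite: Serre1979, Ch. I §1] -/
theorem valuation_zpow_lt_valuation_zpow_iff (a b : ℤ) : valuation F (ϖ ^ a) < valuation F (ϖ ^ b) ↔ b < a := by
  rw [lt_iff_not_ge, valuation_zpow_le_valuation_zpow_iff hϖ, not_le]

include hϖ in
/-- **NO CANCELLATION AGAINST AN EISENSTEIN CONSTANT**: if `|f| ≤ |ϖ^{j+1}|` and `|e′| = |ϖ^{2j+1}|` then for every `z ∈ F`,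
`|z² + f z − e′| = max(|z|², |e′|)` — `|z|²` is an even power of `|ϖ|`, `|e′|` an odd one, and `|f z|` is strictly below the larger of the two.
(This is `|N_{K∕F}(z − μ)| = max(|z|², |N μ|)` for `μ` of odd valuation in a ramified quadratic `K∕F`, written without `K`.) [cite: Serre1979, Ch. I §6] -/
theorem valuation_sq_add_mul_sub_eq_max [IsDiscreteValuationRing 𝒪[F]] {f e' : F} {j : ℕ}
    (hf : valuation F f ≤ valuation F (ϖ ^ (j + 1))) (hj : valuation F e' = valuation F (ϖ ^ (2 * j + 1))) (z : F) :
    valuation F (z ^ 2 + f * z - e') = max (valuation F (z ^ 2)) (valuation F e') := by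
  have h0 := hϖ.ne_zero
  have hf' : valuation F f ≤ valuation F (ϖ ^ ((j : ℤ) + 1)) := by
    rw [← zpow_natCast] at hf; push_cast at hf; exact hf
  have hj' : valuation F e' = valuation F (ϖ ^ (2 * (j : ℤ) + 1)) := by
    rw [← zpow_natCast] at hj; push_cast at hj; exact hj
  by_cases hz0 : z = 0
  · rw [hz0, zero_pow two_ne_zero, mul_zero, zero_add, zero_sub, Valuation.map_neg, map_zero, max_eq_right zero_le]
  obtain ⟨m, hm⟩ := exists_valuation_eq_valuation_zpow hϖ hz0
  have hz2 : valuation F (z ^ 2) = valuation F (ϖ ^ (2 * m)) := by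
    rw [map_pow, hm, ← map_pow, ← zpow_natCast, ← _root_.zpow_mul, mul_comm]; rfl
  have hfz : valuation F (f * z) ≤ valuation F (ϖ ^ ((j : ℤ) + 1 + m)) := by
    rw [map_mul, zpow_add₀ h0 ((j : ℤ) + 1) m, map_mul, hm]
    exact mul_le_mul' hf' le_rfl
  rcases le_or_gt m (j : ℤ) with hmj | hmj
  · -- shallow `z`: the square dominates
    have h1 : valuation F (f * z) < valuation F (z ^ 2) := by
      rw [hz2]; exact lt_of_le_of_lt hfz ((valuation_zpow_lt_valuation_zpow_iff hϖ _ _).2 (by omega))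
    have h2 : valuation F (z ^ 2 + f * z) = valuation F (z ^ 2) := Valuation.map_add_eq_of_lt_left _ h1
    have h3 : valuation F e' < valuation F (z ^ 2 + f * z) := by
      rw [h2, hz2, hj']; exact (valuation_zpow_lt_valuation_zpow_iff hϖ _ _).2 (by omega)
    rw [Valuation.map_sub_eq_of_lt_left _ h3, h2, max_eq_left (h2 ▸ h3).le]
  · -- deep `z`: the Eisenstein constant dominates
    have h1 : valuation F (z ^ 2) < valuation F e' := by
      rw [hz2, hj']; exact (valuation_zpow_lt_valuation_zpow_iff hϖ _ _).2 (by omega)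
    have h2 : valuation F (f * z) < valuation F e' := by
      rw [hj']; exact lt_of_le_of_lt hfz ((valuation_zpow_lt_valuation_zpow_iff hϖ _ _).2 (by omega))
    rw [Valuation.map_sub_eq_of_lt_right _ (Valuation.map_add_lt _ h1 h2), max_eq_right h1.le]

include hϖ in
/-- **THE AFFINE NORM CONDITION** (replaces ★ `norm_condition_iff`'s «completing the square»): `t − 2a = f`, `a² − ta + d = −e′`, `|f| ≤ |ϖ^{j+1}|`,
`|e′| = |ϖ^{2j+1}|`, `e ≤ 1`, any `y′ ∈ F` (no integrality needed): `ϖ^{−(2k+e)}(y′² + t y′ + d) ∈ 𝒪 ↔ k ≤ j ∧ ϖ^{−(k+e)}(y′ + a) ∈ 𝒪` — since `y′² + ty′ + d = (y′+a)² + f(y′+a) − e′`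
has valuation `max(|y′+a|², |ϖ|^{2j+1})` (§1). [cite: Flicker1998UnitaryFL, §6 p. 97] [cite: Serre1979, Ch. I §6] -/
theorem affine_norm_condition_iff [IsDiscreteValuationRing 𝒪[F]] {t d a f e' : F} {j : ℕ}
    (hf : valuation F f ≤ valuation F (ϖ ^ (j + 1))) (hj : valuation F e' = valuation F (ϖ ^ (2 * j + 1)))
    (htf : t - 2 * a = f) (hde : a * a - t * a + d = -e') {k e : ℕ} (he : e ≤ 1) (y' : F) :
    ϖ ^ (-((2 * k + e : ℕ) : ℤ)) * (y' ^ 2 + t * y' + d) ∈ 𝒪[F] ↔ k ≤ j ∧ ϖ ^ (-((k + e : ℕ) : ℤ)) * (y' + a) ∈ 𝒪[F] := by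
  have h0 := hϖ.ne_zero
  have hj' : valuation F e' = valuation F (ϖ ^ (((2 * j + 1 : ℕ)) : ℤ)) := by rw [zpow_natCast]; exact hj
  -- `|ϖ^{-n} z| ≤ 1 ↔ |z| ≤ |ϖ^n|`
  have key : ∀ (n : ℕ) (z : F), ϖ ^ (-(n : ℤ)) * z ∈ 𝒪[F] ↔ valuation F z ≤ valuation F (ϖ ^ (n : ℤ)) := fun n z => by
    rw [Valuation.mem_integer_iff, map_mul, _root_.zpow_neg, map_inv₀, ← div_eq_inv_mul, div_le_one₀ ((Valuation.pos_iff _).2 (zpow_ne_zero _ h0))]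
  have hid : y' ^ 2 + t * y' + d = (y' + a) ^ 2 + f * (y' + a) - e' := by linear_combination (y' + a) * htf + hde
  rw [hid, key, key, valuation_sq_add_mul_sub_eq_max hϖ hf hj (y' + a), max_le_iff]
  by_cases hz0 : y' + a = 0
  · rw [hz0, zero_pow two_ne_zero, map_zero, hj', valuation_zpow_le_valuation_zpow_iff hϖ]
    simp only [zero_le, true_and, and_true]
    constructor
    · intro h; push_cast at h; omega
    · intro h; push_cast; omega
  · obtain ⟨m, hm⟩ := exists_valuation_eq_valuation_zpow hϖ hz0
    have hz2 : valuation F ((y' + a) ^ 2) = valuation F (ϖ ^ (2 * m)) := by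
      rw [map_pow, hm, ← map_pow, ← zpow_natCast, ← _root_.zpow_mul, mul_comm]; rfl
    rw [hz2, hj', hm, valuation_zpow_le_valuation_zpow_iff hϖ, valuation_zpow_le_valuation_zpow_iff hϖ,
      valuation_zpow_le_valuation_zpow_iff hϖ]
    constructor
    · rintro ⟨ha, hb⟩
      exact ⟨by push_cast at hb; omega, by push_cast at ha ⊢; omega⟩
    · rintro ⟨hk, hb⟩
      exact ⟨by push_cast at hb ⊢; omega, by push_cast; omega⟩

end Scalar

/-! ## §2 Membership in `S(!![0, β; σβ, 0], C)` through the strata `k ≤ j` -/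

section Strata

variable {F : Type*} [Field F] [ValuativeRel F] {ϖ : F} (hϖ : IsUniformizingElement ϖ) (σ : F →+* F)
variable [IsDiscreteValuationRing 𝒪[F]]

include hϖ in
/-- **THE EXPONENTS OF A SELF-DUAL `C`-STABLE HERMITE LATTICE (affine centre)**: `l = −k − e` and `0 ≤ k ≤ j` — ★ `exponents_of_selfDual_companionStable` with
`(|2| = 1, |t² − 4d| = |ϖ^{2N+1}|)` replaced by the affine relation at the integer centre `a`. [cite: Flicker1998UnitaryFL, §6 p. 97] -/
theorem exponents_of_selfDual_companionStable_affine (hσϖ : σ ϖ = ϖ) (hσv : ∀ x, valuation F (σ x) = valuation F x)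
    {t d β a f e' : F} (haO : a ∈ 𝒪[F]) (hd : valuation F d = 1) {e : ℕ} (he : e ≤ 1) (hβ : valuation F β = valuation F (ϖ ^ e)) {j : ℕ}
    (hf : valuation F f ≤ valuation F (ϖ ^ (j + 1))) (hj : valuation F e' = valuation F (ϖ ^ (2 * j + 1)))
    {k l : ℤ} {y : F} (γ g : GL (Fin 2) F) (hγ : (γ : Matrix (Fin 2) (Fin 2) F) = !![0, -d; 1, t])
    (hγa : ((γ : Matrix (Fin 2) (Fin 2) F) - a • (1 : Matrix (Fin 2) (Fin 2) F)) * ((γ : Matrix (Fin 2) (Fin 2) F) - a • (1 : Matrix (Fin 2) (Fin 2) F)) =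
      f • ((γ : Matrix (Fin 2) (Fin 2) F) - a • (1 : Matrix (Fin 2) (Fin 2) F)) + e' • (1 : Matrix (Fin 2) (Fin 2) F))
    (hg : (g : Matrix (Fin 2) (Fin 2) F) = !![ϖ ^ k, y; 0, ϖ ^ l])
    (hsd : ∃ J' ∈ glInt 2 F, (J' : Matrix (Fin 2) (Fin 2) F) = formCongr σ g (!![0, β; σ β, 0] : Matrix (Fin 2) (Fin 2) F))
    (hst : (Submodule.span 𝒪[F] (Set.range ((g : Matrix (Fin 2) (Fin 2) F))ᵀ)).map
        ((Matrix.toLin' (γ : Matrix (Fin 2) (Fin 2) F)).restrictScalars 𝒪[F]) = Submodule.span 𝒪[F] (Set.range ((g : Matrix (Fin 2) (Fin 2) F))ᵀ)) :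
    ∃ kn : ℕ, k = kn ∧ l = -(kn : ℤ) - e ∧ kn ≤ j := by
  have h0 := hϖ.ne_zero
  obtain ⟨htf, hde⟩ := companion_affine_entries γ hγ hγa
  have hfO : f ∈ 𝒪[F] := (Valuation.mem_integer_iff _ _).2 (hf.trans ((Valuation.mem_integer_iff _ _).1 ((𝒪[F]).pow_mem hϖ.mem _)))
  have ht : t ∈ 𝒪[F] := by
    rw [show t = a + a + f by linear_combination htf]; exact (𝒪[F]).add_mem ((𝒪[F]).add_mem haO haO) hfO
  obtain ⟨hval, -⟩ := (exists_mem_glInt_coe_eq_formCongr_hermite_antidiag_iff σ hϖ hσϖ hσv g hg).1 hsd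
  obtain ⟨hlk, -, hnorm⟩ := (map_companion_span_eq_self_iff_of_hermite hϖ γ g hγ hd ht hg).1 hst
  -- `|β ϖ^{k+l}| = |ϖ^{e+k+l}| = 1 ⇒ e + k + l = 0`
  have hekl : (e : ℤ) + (k + l) = 0 := by
    rw [map_mul, hβ, ← map_mul, ← zpow_natCast, ← zpow_add₀ h0, valuation_zpow_uniformizer_eq_one_iff hϖ] at hval
    exact hval
  have hk0 : 0 ≤ k := by omega
  obtain ⟨kn, rfl⟩ := Int.eq_ofNat_of_zero_le hk0
  have hl : l = -(kn : ℤ) - e := by omega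
  refine ⟨kn, rfl, hl, ?_⟩
  have hid := (companion_rescale_identities h0 hl y t d β (σ β) (σ y)).1
  rw [hid] at hnorm
  exact ((affine_norm_condition_iff hϖ hf hj htf hde he _).1 hnorm).1

include hϖ in
/-- **MEMBERSHIP THROUGH THE STRATA (affine centre)**: `Λ ∈ S(!![0, β; σβ, 0], C)` iff for some `0 ≤ k ≤ j` it is a self-dual `C`-stable Hermite lattice
`Λ(T(k, y, −k−e))` — ★ `mem_selfDualStable_antidiag_companion_iff` with the affine relation in place of `|2| = 1`, `|t² − 4d|` odd. [cite: Flicker1998UnitaryFL, §6 p. 97]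
[cite: Macdonald1995, Ch. V §2] -/
theorem mem_selfDualStable_antidiag_companion_iff_affine (hσϖ : σ ϖ = ϖ) (hσv : ∀ x, valuation F (σ x) = valuation F x)
    (hσO : ∀ x : 𝒪[F], σ x ∈ 𝒪[F]) {t d β a f e' : F} (haO : a ∈ 𝒪[F]) (hd : valuation F d = 1) {e : ℕ} (he : e ≤ 1)
    (hβ : valuation F β = valuation F (ϖ ^ e)) {j : ℕ} (hf : valuation F f ≤ valuation F (ϖ ^ (j + 1)))
    (hj : valuation F e' = valuation F (ϖ ^ (2 * j + 1))) (γ : GL (Fin 2) F) (hγ : (γ : Matrix (Fin 2) (Fin 2) F) = !![0, -d; 1, t])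
    (hγa : ((γ : Matrix (Fin 2) (Fin 2) F) - a • (1 : Matrix (Fin 2) (Fin 2) F)) * ((γ : Matrix (Fin 2) (Fin 2) F) - a • (1 : Matrix (Fin 2) (Fin 2) F)) =
      f • ((γ : Matrix (Fin 2) (Fin 2) F) - a • (1 : Matrix (Fin 2) (Fin 2) F)) + e' • (1 : Matrix (Fin 2) (Fin 2) F))
    (Λ : Submodule 𝒪[F] (Fin 2 → F)) :
    Λ ∈ {Λ : Submodule 𝒪[F] (Fin 2 → F) |
        (∃ g : GL (Fin 2) F, (∃ J' ∈ glInt 2 F, (J' : Matrix (Fin 2) (Fin 2) F) = formCongr σ g (!![0, β; σ β, 0] : Matrix (Fin 2) (Fin 2) F)) ∧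
          Λ = Submodule.span 𝒪[F] (Set.range ((g : Matrix (Fin 2) (Fin 2) F))ᵀ)) ∧
        Λ.map ((Matrix.toLin' (γ : Matrix (Fin 2) (Fin 2) F)).restrictScalars 𝒪[F]) = Λ} ↔
      ∃ k : ℕ, k ≤ j ∧ ∃ (y : F) (g : GL (Fin 2) F), (g : Matrix (Fin 2) (Fin 2) F) = !![ϖ ^ (k : ℤ), y; 0, ϖ ^ (-(k : ℤ) - e)] ∧
        (∃ J' ∈ glInt 2 F, (J' : Matrix (Fin 2) (Fin 2) F) = formCongr σ g (!![0, β; σ β, 0] : Matrix (Fin 2) (Fin 2) F)) ∧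
        (Submodule.span 𝒪[F] (Set.range ((g : Matrix (Fin 2) (Fin 2) F))ᵀ)).map ((Matrix.toLin' (γ : Matrix (Fin 2) (Fin 2) F)).restrictScalars 𝒪[F]) =
          Submodule.span 𝒪[F] (Set.range ((g : Matrix (Fin 2) (Fin 2) F))ᵀ) ∧
        Λ = Submodule.span 𝒪[F] (Set.range ((g : Matrix (Fin 2) (Fin 2) F))ᵀ) := by
  constructor
  · rintro ⟨⟨g₀, hsd₀, rfl⟩, hst⟩
    obtain ⟨k, l, y, g, hg, hΛ⟩ := exists_hermite_span_eq hϖ g₀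
    have hsd : ∃ J' ∈ glInt 2 F, (J' : Matrix (Fin 2) (Fin 2) F) = formCongr σ g (!![0, β; σ β, 0] : Matrix (Fin 2) (Fin 2) F) :=
      exists_mem_glInt_coe_eq_formCongr_of_span_eq σ hσO _ hΛ hsd₀
    rw [hΛ] at hst
    obtain ⟨kn, rfl, rfl, hkN⟩ := exponents_of_selfDual_companionStable_affine hϖ σ hσϖ hσv haO hd he hβ hf hj γ g hγ hγa hg hsd hst
    exact ⟨kn, hkN, y, g, hg, hsd, hst, hΛ⟩
  · rintro ⟨k, -, y, g, hg, hsd, hst, rfl⟩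
    exact ⟨⟨g, hsd, rfl⟩, hst⟩

end Strata

/-! ## §3 Re-centring to a twisted-trace-free centre -/

section Recentre

variable {F : Type*} [Field F] [ValuativeRel F] {ϖ : F} (hϖ : IsUniformizingElement ϖ) (σ : F →+* F)
  (σO : 𝒪[F] →+* 𝒪[F]) (hσO' : ∀ x : 𝒪[F], ((σO x : 𝒪[F]) : F) = σ x) (hσσ : ∀ x, σO (σO x) = x)
  (hσv : ∀ x, valuation F (σ x) = valuation F x)
  {t d β : F} {e : ℕ} (hβ : valuation F β = valuation F (ϖ ^ e)) {j : ℕ}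

include hϖ hσO' hσσ hσv hβ in
/-- **RE-CENTRING TO A TWISTED-TRACE-FREE CENTRE**: if the affine centre `a` has `|β·σa + σβ·a| ≤ |ϖ^{j+1+e}|` then some `a₁ ∈ a + 𝔪^{j+1}` has `β·σa₁ + σβ·a₁ = 0`
EXACTLY, and `(a₁, f₁ := f − 2(a₁ − a), e₁)` is again an affine datum of the same shape (`|f₁| ≤ |ϖ^{j+1}|`, `|e₁| = |ϖ^{2j+1}|`, `t − 2a₁ = f₁`, `a₁² − ta₁ + d = −e₁`):
take `a₁ = a − (σβ)⁻¹·ε·(β·σa + σβ·a)` with `ε = a₀(a₀ − σa₀)⁻¹`, `ε + σε = 1` (unramified trace). [cite: Serre1979, Ch. V §2] -/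
theorem exists_recentre_twistedTrace_eq_zero {a₀ : 𝒪[F]} (ha₀ : IsUnit (σO a₀ - a₀)) {a f e' : F} (haO : a ∈ 𝒪[F])
    (hf : valuation F f ≤ valuation F (ϖ ^ (j + 1))) (hj : valuation F e' = valuation F (ϖ ^ (2 * j + 1)))
    (htf : t - 2 * a = f) (hde : a * a - t * a + d = -e') (hβa' : valuation F (β * σ a + σ β * a) ≤ valuation F (ϖ ^ (j + 1 + e))) :
    ∃ a₁ f₁ e₁ : F, a₁ ∈ 𝒪[F] ∧ valuation F f₁ ≤ valuation F (ϖ ^ (j + 1)) ∧ valuation F e₁ = valuation F (ϖ ^ (2 * j + 1)) ∧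
      t - 2 * a₁ = f₁ ∧ a₁ * a₁ - t * a₁ + d = -e₁ ∧ β * σ a₁ + σ β * a₁ = 0 ∧ valuation F (a₁ - a) ≤ valuation F (ϖ ^ (j + 1)) := by
  have h0 := hϖ.ne_zero
  have hσO : ∀ x : 𝒪[F], σ x ∈ 𝒪[F] := fun x => by rw [← hσO' x]; exact (σO x).2
  have hσσF : ∀ x : 𝒪[F], σ (σ (x : F)) = x := fun x => by
    have := congrArg (fun y : 𝒪[F] => (y : F)) (hσσ x); rwa [hσO', hσO'] at this
  have hϖO : ∀ n : ℕ, valuation F (ϖ ^ n) ≤ 1 := fun n => (Valuation.mem_integer_iff _ _).1 ((𝒪[F]).pow_mem hϖ.mem n)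
  have hβO : β ∈ 𝒪[F] := (Valuation.mem_integer_iff _ _).2 (hβ ▸ hϖO e)
  have hβ0 : β ≠ 0 := fun h => by
    rw [h, map_zero] at hβ; exact (pow_ne_zero e h0) ((Valuation.zero_iff _).1 hβ.symm)
  have hσβ0 : σ β ≠ 0 := (map_ne_zero σ).2 hβ0
  set c : F := β * σ a + σ β * a with hc
  have hσc : σ c = c := by rw [hc, map_add, map_mul, map_mul, hσσF ⟨β, hβO⟩, hσσF ⟨a, haO⟩]; ring
  -- the trace-one element `ε`
  have hw0 : ((a₀ : F) - σ a₀) ≠ 0 := by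
    intro h
    obtain ⟨w, hw⟩ := ha₀
    have h1 : ((σO a₀ - a₀ : 𝒪[F]) : F) = 0 := by push_cast; rw [hσO']; linear_combination -h
    have h2 : (σO a₀ - a₀ : 𝒪[F]) = 0 := Subtype.ext h1
    rw [← hw] at h2
    exact w.ne_zero h2
  have hwv : valuation F ((a₀ : F) - σ a₀) = 1 := by
    obtain ⟨w, hw⟩ := ha₀
    have h1 : ((a₀ : F) - σ a₀) = -((w : 𝒪[F]) : F) := by rw [hw]; push_cast; rw [hσO']; ring
    rw [h1, Valuation.map_neg]
    exact (Valuation.integer.integers (valuation F)).valuation_unit w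
  set ε : F := (a₀ : F) * ((a₀ : F) - σ a₀)⁻¹ with hε
  have hσw0 : (σ a₀ - (a₀ : F)) ≠ 0 := fun h => hw0 (by linear_combination -h)
  have hεtr : ε + σ ε = 1 := by
    rw [hε, map_mul, map_inv₀, map_sub, hσσF a₀]
    field_simp
    ring
  have hεv : valuation F ε ≤ 1 := by
    rw [hε, map_mul, map_inv₀, hwv, inv_one, mul_one]; exact (Valuation.mem_integer_iff _ _).1 a₀.2
  -- the shift `δ` with `β σδ + σβ δ = −c` and `|δ| ≤ |ϖ^{j+1}|`
  set δ : F := -((σ β)⁻¹ * ε * c) with hδ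
  have hTδ : β * σ δ + σ β * δ = -c := by
    rw [hδ, map_neg, map_mul, map_mul, map_inv₀, hσσF ⟨β, hβO⟩, hσc]
    field_simp
    linear_combination (-c) * hεtr
  have hδv : valuation F δ ≤ valuation F (ϖ ^ (j + 1)) := by
    rw [hδ, Valuation.map_neg, map_mul, map_mul, map_inv₀, hσv, hβ]
    have h1 : valuation F ε * valuation F c ≤ valuation F (ϖ ^ (j + 1 + e)) :=
      (mul_le_mul' hεv hβa').trans (by rw [one_mul])
    have hpe : valuation F (ϖ ^ e) ≠ 0 := by rw [Ne, Valuation.zero_iff]; exact pow_ne_zero _ h0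
    calc (valuation F (ϖ ^ e))⁻¹ * valuation F ε * valuation F c
        = (valuation F (ϖ ^ e))⁻¹ * (valuation F ε * valuation F c) := mul_assoc _ _ _
      _ ≤ (valuation F (ϖ ^ e))⁻¹ * valuation F (ϖ ^ (j + 1 + e)) := mul_le_mul' le_rfl h1
      _ = valuation F (ϖ ^ (j + 1)) := by rw [pow_add, map_mul, mul_comm (valuation F (ϖ ^ (j + 1))), inv_mul_cancel_left₀ hpe]
  refine ⟨a + δ, f - 2 * δ, e' + f * δ - δ * δ, (𝒪[F]).add_mem haO ((Valuation.mem_integer_iff _ _).2 (hδv.trans (hϖO _))), ?_, ?_,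
    by linear_combination htf, by linear_combination hde - δ * htf, by rw [map_add]; linear_combination hTδ - hc,
    by rw [add_sub_cancel_left]; exact hδv⟩
  · -- `|f − 2δ| ≤ |ϖ^{j+1}|`
    have h2 : valuation F (2 : F) ≤ 1 :=
      (Valuation.mem_integer_iff _ _).1 (by rw [show (2 : F) = 1 + 1 by norm_num]; exact (𝒪[F]).add_mem (𝒪[F]).one_mem (𝒪[F]).one_mem)
    refine (Valuation.map_sub _ _ _).trans (max_le hf ?_)
    rw [map_mul]; exact (mul_le_mul' h2 hδv).trans (by rw [one_mul])
  · -- `|e′ + fδ − δ²| = |e′|`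
    have hsmall : valuation F (f * δ - δ * δ) < valuation F e' := by
      have hjj : valuation F (ϖ ^ (j + 1)) * valuation F (ϖ ^ (j + 1)) < valuation F (ϖ ^ (2 * j + 1)) := by
        rw [← map_mul, ← pow_add, ← zpow_natCast, ← zpow_natCast, valuation_zpow_lt_valuation_zpow_iff hϖ]; push_cast; omega
      rw [hj]
      refine Valuation.map_sub_lt _ ?_ ?_
      · rw [map_mul]; exact lt_of_le_of_lt (mul_le_mul' hf hδv) hjj
      · rw [map_mul]; exact lt_of_le_of_lt (mul_le_mul' hδv hδv) hjj
    rw [show e' + f * δ - δ * δ = e' + (f * δ - δ * δ) by ring, Valuation.map_add_eq_of_lt_left _ hsmall, hj]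

end Recentre

end Literature.NumberTheory.Automorphic

end
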